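import Mathlib
import Summits.Parity.BatemanHorn.Theses.PolynomialMobius
import Summits.Parity.BatemanHorn.Theses.IsogenyRedei
import Summits.Parity.BatemanHorn.Theorems.PolynomialMobiusPolyMobiusTailStubWindowLinearLeOne
import Summits.Parity.BatemanHorn.Theorems.PolynomialMobiusPolyMobiusTailStubPairCorner
import Summits.Parity.BatemanHorn.Theorems.PolynomialMobiusPolyMobiusTailStubPairMiddle
import Summits.Parity.BatemanHorn.Theorems.PolynomialMobiusPolyMobiusTailStubPairBalanced
import Summits.Parity.BatemanHorn.Theorems.PolynomialMobiusPolyMobiusTailWindowLinearPair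

/-!
# Skeleton v4 — crux stmt-Parity-0870 `PolyMobiusTail`, line `eta-free-multilinear-window`
# (v4, lead c3, 2026-08-17: the k = 2 LINEAR PAIR WINDOW is PROVED — `stub_pair_corner` p146909,
# `stub_pair_middle` p148016, `stub_pair_balanced` p145202, composed `stub_window_linear_pair` p148167;
# sorries = the three open stubs S2/S3/S4 only)
# (the window / large-part anatomy, typed once for every system)

Crux-strategist `planner-cstrat-stmt-Parity-0870-p1-0` (wall-breaker pass, 2026-08-17), realising the crux
idea `Ideas/eta-free-multilinear-window.md` (ideator 1, round 1; PASSED triage r1 3/3 — TRIAGE-r1-1/2/3 — but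
never planned: the round's only crux-plan seat went to the merged, failed idea) with the triagers'
sharpenings (k-uniform η₀ dropped; `k ≤ 2` linear window theorem-grade, `k ≥ 3` a separate open stub;
LARGE part typed AFTER the divisor switch so that it is visibly Möbius of the cofactors; B20 of
`BarrierNotesIdeator4.md` for the clean k-linear phase).

## The cut (per system `f`, parameters `0 < η < 1`, `0 < θ < 1`)

The crux's tail `Tail_η(x) = Σ_{n ≤ x} Σ_{dᵢ ∣ fᵢ(n), x^{1-η} < ∏ dᵢ} ∏ μ(dᵢ) log dᵢ` splits EXACTLY as

  `Tail_η(x) = Win_{η,θ}(x) + Large_θ(x)`,   `Win`: `x^{1-η} < ∏ dᵢ ≤ x^{1+θ}`,   `Large`: `x^{1+θ} < ∏ dᵢ`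

(`tail_eq_window_add_large`, proved below), and the large part equals its COFACTOR form
`Large_θ(x) = Σ_{n ≤ x} Σ_{eᵢ ∣ fᵢ(n), x^{1+θ} < ∏ fᵢ(n)/eᵢ} ∏ μ(fᵢ(n)/eᵢ) log(fᵢ(n)/eᵢ)`
(`large_divisor_switch`, proved below: the involution `d ↦ f(n)/d` coordinatewise). So

  `PolyMobiusTail ⟸ [∀ f ∃ θ ∃ η : Win_{η,θ} = o(x)] ∧ [∀ f ∀ θ : Large_θ = o(x)]`.

WINDOW = moduli of size `x^{1±o(1)}…x^{1+θ}` against an `n`-range of length `x`: a DENSE set of moduli,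
where after Poisson on the product modulus `D = ∏ dᵢ` and CRT the count is a `k`-linear form in Kloosterman
FRACTIONS with coefficients `∏ μ(dᵢ) log dᵢ` (free numerators `ℓhᵢ` for linear members `X + hᵢ`, root
numerators for members of degree ≥ 2) — modulus-side bilinear technology, NOT parity. LARGE = Möbius of the
cofactors `fᵢ(n)/eᵢ` along the cofactor pencils `∏ eᵢ < ∏ fᵢ(n)/x^{1+θ}` (for `k = 1`, `deg f = G`:
`e ≤ C·x^{G-1-θ}`, pencil members `g_{e,r}(j) = f(r + ej)/e` of length `x/e`), with the `(log x)^{-k}` saving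
that the log weights demand — the PARITY CORE (items 9648 / 0871 / 14950 in μ-currency, all systems at once).

## Stubs (registered; `sorry` ONLY here) and composition

* `stub_window_linear_le_one`   — systems with `k ≤ 1` and every member of degree ≤ 1: THEOREM-GRADE NOW (M).
  `k = 0`: the window is empty for every `x ≥ 1` (`∏∅ = 1 ≤ x^{1-η}`); `k = 1`, `f = (qX+a)`: the whole tail is
  `o(x)` at every `η` (LANDED `…Theorems.PolyMobiusTail.NaturalForm.stub_degreeOneSlice`, p114749) and
  `Large_θ = 0` eventually (`d ≤ qx + a < x^{1+θ}`), so window = tail − large eventually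
  (`tail_eq_window_add_large` below); degree-0 members are excluded by the BH axioms (a positive irreducible
  constant is a prime `p`, a fixed prime divisor).
* `window_linear_pair_of_stubs` (was `stub_window_linear_pair`; RESHAPED by lead c3 into the registered
  range stubs `stub_pair_corner` [L: BV for μ], `stub_pair_middle` [XL: dispersion + Weil],
  `stub_pair_balanced` [XL: DFI 1997 Theorem 1, PROVED in tree], glue proved) — `k = 2`, degree ≤ 1 (XL).
  `(q₁X+a₁, q₂X+a₂)`: Poisson dual phase (monic case) `e(ℓh₂/(d₁d₂))·e(ℓ(h₁−h₂)d̄₁/d₂)` = the tree's TWISTED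
  DFI-1997 form (`Literature.NumberTheory.LFunctions.DukeFriedlanderIwaniec1997_bilinearKloostermanFractions`,
  `_holds` PROVED in tree) in the balanced range (fixed `qᵢ` only insert fixed inverses), Cauchy +
  (in)complete Kloosterman / Weil in the unbalanced range, Bombieri–Vinogradov (`bombieri_vinogradov_holds`)
  in the corner `min dᵢ ≤ x^{η'}`; net saving ≈ x^{1/96} at `d₁ ≍ d₂` ⇒ some `θ = η ≈ 10⁻³` works (TRIAGE-r1-1
  evidence 2, TRIAGE-r1-3). The log-singular-series slice of the main terms is `o(x)` by η-rigidity
  (`…Theorems.PolyMobiusTail.Negative.Equivalence.polyMobiusTail_iff_forall_eta` + `typeIMainTerm_proof`).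
* `stub_window_linear_three_le` — systems with `k ≥ 3`, all members linear: OPEN but parity-free. The phase is
  `e(−ℓΣhᵢ/D)·∏ᵢ e(ℓhᵢ·d̄ᵢ/(D/dᵢ))` (B20): a CYCLIC PRODUCT of clean Kloosterman fractions; Cauchy +
  completion closes the shapes with one `dᵢ ≤ x^{η'}` (recursion to `k−1`) or one dominant `dᵢ`; the
  balanced corner `dᵢ ≍ D^{1/k}` is a genuinely multilinear Kloosterman-fraction problem not in print
  (Bettin–Chandee's trilinear form has its third variable in the NUMERATOR — a different object).
* `stub_window_nonlinear`       — systems with a member of degree ≥ 2: OPEN, parity-free, graded by degree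
  profile. `X²+1`: the window at the balanced semiprime moduli `d = p·r`, `p ≍ r ≍ x^{(1+θ)/2}` is route
  GaussianFractions' engine (RootFractionsBound 12214 → RootLevelBeyondHalf 12215: entangled root numerators
  `e(hν_p r̄/p)e(hν_r p̄/r)`), Grimmelt–Merikoski Type I/II (`grimmeltMerikoski2025_thm14_restricted/thm15`)
  covering the rest; degree ≥ 3 members: completion barrier / generator-parametrisation wall / open divisor
  level (`BarrierNotesIdeator2.md` B1, B4, B6) — only Hooley's `(log)^{-δ}` in print. This is Sawin–Shusterman's
  "third range", "not yet resolved over ℤ" (arXiv:2008.09905 §1.3).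
* `stub_large`                  — every system, every `θ ∈ (0,1)`, COFACTOR form: the parity core with level
  and log-rate. No tool in print (Selberg / Bombieri indeterminacy; B22: the large range is self-dual, no
  intermediate slab is cheaper than its mirror image — hence ONE stub, not a ladder).
* `PolyMobiusTail_of` : the crux BY NAME (`…Theses.IsogenyRedei.PolyMobiusTail`; the PolynomialMobius twin
  by `PolyMobiusTail_of_polynomialMobius`), from the five stubs by the case split linear `k ≤ 1` / `k = 2` /
  `k ≥ 3` / nonlinear, `large_divisor_switch` and `tail_eq_window_add_large` — all glue PROVED here.

Honest status (card `Lines/eta-free-multilinear-window.md`): on every slice, (window ∧ large) is jointly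
summit-strength (it implies the crux slice, hence Λ-BH for that system, `Negative/Equivalence`); separately,
neither stub is implied by or implies the crux, none is Λ-BH for any class of systems, and the window stubs
are modulus-side bilinear statements with tools. The line RELOCATES parity into `stub_large`, it does not
shrink it; its deliverables are the window theorems and the exact localisation, typed once for the five
routes sharing 0870.

Disproof used: `Disproof.lean` §1/§1b (crux ⟺ Λ-BH; η-freeness — the lower cut `x^{1-η}` is immaterial, so a
worker may take `η` as small as the window engine wants), §3 (only `pairwise_not_associated` load-bearing:
every stub keeps the full `IsBatemanHornSystem` hypothesis; no `_false_without_` theorem is violated — the only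
one, `polyMobiusTail_false_without_nonAssoc`, is a near-miss about dropping that field), §5 (no termwise-in-`n`
bound is claimed: all five stubs are signed sums over `n`), §8 / p114749 (degree-one anchor, consumed by
`stub_window_linear_le_one`). Landed Negative lemmas checked against: `polyMobiusTail_abs_false`,
`polyMobiusTail_primeDivisors_false`, `polyMobiusTail_allEtaClosed_false` — no stub is an instance (open
η/θ-ranges, signed, all divisor tuples).
-/

open scoped BigOperators Topology
open Filter Finset Polynomial Asymptotics

namespace Summit.Parity.BatemanHorn.Cruxes.PolyMobiusTail.EtaFreeMultilinearWindow

open Literature.NumberTheory.Sieve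

/-! ## The five registered stubs (self-contained signatures: Mathlib + `IsBatemanHornSystem` only) -/

/-- **S1a · WINDOW, linear systems with `k ≤ 1` — LANDED (p138278, `…Theorems.PolyMobiusTail.EtaFreeWindow.stub_window_linear_le_one`, worker W1 of lead c3).** For a Bateman–Horn system of at
most one member, of degree ≤ 1, some window `(x^{1-η}, x^{1+θ}]` of the Möbius tail is `o(x)`:
`Σ_{n≤x} Σ_{dᵢ∣fᵢ(n), x^{1-η} < ∏dᵢ ≤ x^{1+θ}} ∏ μ(dᵢ) log dᵢ = o(x)`.
`k = 0`: every summand vanishes (`∏∅ = 1 ≤ x^{1-η}` for `x ≥ 1`); `k = 1`, `f = (qX+a)` (degree 0 is excluded by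
the BH axioms): the tail at cut `x^{1-η}` is `o(x)` for EVERY `η ∈ (0,1)` (landed
`Summit.Parity.BatemanHorn.Theorems.PolyMobiusTail.NaturalForm.stub_degreeOneSlice`, p114749), the large part
`x^{1+θ} < d` is empty once `qx + a < x^{1+θ}`, and window = tail − large (`tail_eq_window_add_large`). Any
`θ, η ∈ (0,1)` work. Why plausibly true: it follows from landed theorems. Size: M. -/
theorem window_linear_le_one : ∀ (k : ℕ) (f : Fin k → ℤ[X]), IsBatemanHornSystem f → k ≤ 1 →
    (∀ i, (f i).natDegree ≤ 1) →
    ∃ θ : ℝ, 0 < θ ∧ θ < 1 ∧ ∃ η : ℝ, 0 < η ∧ η < 1 ∧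
      (fun x : ℕ => ∑ n ∈ Finset.Icc 1 x,
        ∑ d ∈ Fintype.piFinset (fun i => (((f i).eval (n : ℤ)).toNat).divisors),
          if (x : ℝ) ^ (1 - η) < ∏ i, (d i : ℝ) ∧ ∏ i, (d i : ℝ) ≤ (x : ℝ) ^ (1 + θ) then
            ∏ i, ((ArithmeticFunction.moebius (d i) : ℝ) * Real.log (d i)) else 0)
        =o[atTop] fun x : ℕ => (x : ℝ) :=
  Summit.Parity.BatemanHorn.Theorems.PolyMobiusTail.EtaFreeWindow.stub_window_linear_le_one

/-! ### S1b · WINDOW, linear PAIRS `k = 2` (theorem-grade, XL) — the line's deliverable, RESHAPED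

For a Bateman–Horn system of two members of degree ≤ 1 (`(q₁X+a₁, q₂X+a₂)`, e.g. twins `(X, X+2)`), some
window `(x^{1-η}, x^{1+θ}]` of the Möbius tail is `o(x)` (`window_linear_pair_of_stubs`, proved below from
three range stubs).  Strategist's sketch: after Poisson on `D = d₁d₂` the count
`#{n ≤ x : d₁ ∣ q₁n+a₁, d₂ ∣ q₂n+a₂}` is `x·ρ/D + ψ((x−n₀)/D) − ψ(−n₀/D)` with `n₀/D` a Kloosterman fraction
(monic case: `≡ −h₁/D − (h₂−h₁)·d̄₁/d₂`), so the window is a bilinear form with coefficients `μ log ⊗ μ log`;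
net saving ≈ `x^{1/96}` at `d₁ ≍ d₂` (TRIAGE-r1-1 ev. 2, TRIAGE-r1-3).

### S1b reshaped (lead c3, 2026-08-17): three RANGE stubs by the size of `d_min = min(d₁, d₂)`

For a pair `f = (f₀, f₁)` of degree ≤ 1 write the window summand with an extra range condition on
`m := min (d 0) (d 1)`.  The window `x^{1-η} < d₀d₁ ≤ x^{1+θ}` is the disjoint union of
`m ≤ x^{σ₁}` (CORNER), `x^{σ₁} < m ≤ x^{σ₂}` (MIDDLE) and `x^{σ₂} < m` (BALANCED); the glue
`window_linear_pair_of_stubs` below takes `σ₁ = 3/10`, `σ₂ = 12/25` and `θ = η = min cᵢ`.  Each range is a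
theorem-programme over tools PROVED in the tree:

* CORNER (`σ < 1/3`): reparametrise by `(d_min, m_other = f_other(n)/d_other)`, `m_other ≤ q x^{σ+η}`; for fixed
  `(d_min, m_other)` the `d_other`-sum is `μ·log` over `≤ C(f)` reduced residue classes modulo (a divisor of)
  `q_other·d_min·rad(gcd)` on an interval of length `≍ x^{1-σ-η}/d_min`; Bombieri–Vinogradov for `μ`
  (`Literature.NumberTheory.Sieve.bombieriVinogradov_moebius`, level `x^σ ≤ (x/m)^{1/2}(log)^{-B}` iff `3σ + η < 1`)
  with the subtracted coprime mean bounded by Siegel–Walfisz for `μ`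
  (`LFunctions.SiegelWalfiszMoebius.sum_coprime_progression_le`), partial summation for the `log`; no main term.
* MIDDLE (`0 < σ₁ < σ₂ < 1/2`): Linnik dispersion — Cauchy over the long rough variable `d_other`, Poisson in
  `d_other` (smooth majorant), diagonal `≪ x² (log)^{C}/M` with `M = f_other(n)/d_other ≍ x·d_min/D ≥ x^{σ₁-θ-o(1)}`,
  off-diagonal main terms by the prime number theorem for `μ` with coprimality twists (`gcd(d, d') ∣ q Δ (m − m')`),
  non-zero frequencies = a product of two incomplete Kloosterman sums `Σ_m e(a m̄/d)` to squarefree moduli → Weil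
  (`Literature/NumberTheory/LFunctions/Kloosterman*.lean`); admissible while `d_min ≤ x^{1/2-θ/2-2ε}`.
* BALANCED (`5/11 < σ < 1/2`): `f₀(n) = d₀m₀`, `f₁(n) = d₁m₁` ⇒ `m₀(q₁d₀) − m₁(q₀d₁) = q₁a₀ − q₀a₁ ≠ 0`, a
  DETERMINANT EQUATION with smooth upper row `(m₀, m₁)` and general lower row `(q₀d₁, q₁d₀)` weighted by
  `μ log ⊗ μ log`: Duke–Friedlander–Iwaniec 1997 Theorem 1
  (`Literature.NumberTheory.LFunctions.DukeFriedlanderIwaniec1997_determinant_holds`, PROVED in the tree) on fine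
  boxes `(D, D(1+κ)]`, `κ = (log x)^{-C}` (DFI's `η = κ⁻¹`, harmless against the saving `x^{1/96}`), boundary layers of
  the sharp cut-offs `n ≤ x`, `d₀d₁ ≤ x^{1+θ}` `≪ κ x (log x)^4` (double divisor switch + Type I), DFI main term
  `o(x)` by cancellation of `Σ μ(d) log d · c(d)/d` in each variable; the error is `< x^{1-ε}` iff
  `(53/48)(1+θ) − 11σ/48 < 1`, e.g. `θ < 4·10⁻³` at `σ = 12/25` (`gcd(q₀,q₁) > 1` costs extra congruence bookkeeping).
-/

/-- **S1b-P1 · CORNER of the linear pair window — LANDED p146909 (`…Theorems.PolyMobiusTail.EtaFreeWindow.stub_pair_corner`, W2/W2b of lead c3).** For a Bateman–Horn pair of degree ≤ 1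
and `0 < σ < 1/3` there is `c > 0` such that for all `θ, η ∈ (0, c]` the part of the window
`x^{1-η} < d₀d₁ ≤ x^{1+θ}` with `min(d₀, d₁) ≤ x^σ` is `o(x)`.  Proof route: Bombieri–Vinogradov for `μ`
(tree `bombieriVinogradov_moebius`) after the reparametrisation `(d_min, m_other)`, see the section docstring.
Why plausibly true: BV level `x^σ` against progressions of length `≥ x^{1-σ-η}/d_min`, `3σ + η < 1`. Size: L. -/
theorem stub_pair_corner : ∀ (f : Fin 2 → ℤ[X]), IsBatemanHornSystem f → (∀ i, (f i).natDegree ≤ 1) →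
    ∀ σ : ℝ, 0 < σ → σ < 1 / 3 →
    ∃ c : ℝ, 0 < c ∧ ∀ θ η : ℝ, 0 < θ → θ ≤ c → 0 < η → η ≤ c →
      (fun x : ℕ => ∑ n ∈ Finset.Icc 1 x,
        ∑ d ∈ Fintype.piFinset (fun i => (((f i).eval (n : ℤ)).toNat).divisors),
          if (x : ℝ) ^ (1 - η) < ∏ i, (d i : ℝ) ∧ ∏ i, (d i : ℝ) ≤ (x : ℝ) ^ (1 + θ) ∧
              ((min (d 0) (d 1) : ℕ) : ℝ) ≤ (x : ℝ) ^ σ then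
            ∏ i, ((ArithmeticFunction.moebius (d i) : ℝ) * Real.log (d i)) else 0)
        =o[atTop] fun x : ℕ => (x : ℝ) :=
  Summit.Parity.BatemanHorn.Theorems.PolyMobiusTail.EtaFreeWindow.stub_pair_corner

/-- **S1b-P2 · MIDDLE of the linear pair window — LANDED p148016 (`…EtaFreeWindow.stub_pair_middle`, lead c3 + workers W8–W13).** For a Bateman–Horn pair of degree ≤ 1
and `0 < σ₁ < σ₂ < 1/2` there is `c > 0` such that for all `θ, η ∈ (0, c]` the part of the window with
`x^{σ₁} < min(d₀, d₁) ≤ x^{σ₂}` is `o(x)`.  Proof route: dispersion (Cauchy over `d_other`, Poisson, PNT for `μ` with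
coprimality twists for the main terms, Weil for the incomplete Kloosterman sums over the short smooth cofactor
`m_other`), see the section docstring.  Why plausibly true: every modulus is `≤ x^{1/2-θ/2-2ε}` and the cofactor
length `M ≍ x d_min/D → ∞` as a power. Size: XL. -/
theorem stub_pair_middle : ∀ (f : Fin 2 → ℤ[X]), IsBatemanHornSystem f → (∀ i, (f i).natDegree ≤ 1) →
    ∀ σ₁ σ₂ : ℝ, 0 < σ₁ → σ₁ < σ₂ → σ₂ < 1 / 2 →
    ∃ c : ℝ, 0 < c ∧ ∀ θ η : ℝ, 0 < θ → θ ≤ c → 0 < η → η ≤ c →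
      (fun x : ℕ => ∑ n ∈ Finset.Icc 1 x,
        ∑ d ∈ Fintype.piFinset (fun i => (((f i).eval (n : ℤ)).toNat).divisors),
          if (x : ℝ) ^ (1 - η) < ∏ i, (d i : ℝ) ∧ ∏ i, (d i : ℝ) ≤ (x : ℝ) ^ (1 + θ) ∧
              ((x : ℝ) ^ σ₁ < ((min (d 0) (d 1) : ℕ) : ℝ) ∧ ((min (d 0) (d 1) : ℕ) : ℝ) ≤ (x : ℝ) ^ σ₂) then
            ∏ i, ((ArithmeticFunction.moebius (d i) : ℝ) * Real.log (d i)) else 0)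
        =o[atTop] fun x : ℕ => (x : ℝ) :=
  Summit.Parity.BatemanHorn.Theorems.PolyMobiusTail.EtaFreeWindow.stub_pair_middle

/-- **S1b-P3 · BALANCED part of the linear pair window — LANDED p145202 (`…EtaFreeWindow.stub_pair_balanced`, W3/W3b of lead c3) — the DFI range.** For a
Bateman–Horn pair of degree ≤ 1 and `5/11 < σ < 1/2` there is `c > 0` such that for all `θ, η ∈ (0, c]` the part
of the window with `x^σ < min(d₀, d₁)` is `o(x)`.  Proof route: the determinant equation
`m₀(q₁d₀) − m₁(q₀d₁) = q₁a₀ − q₀a₁` and Duke–Friedlander–Iwaniec 1997 Theorem 1 (tree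
`DukeFriedlanderIwaniec1997_determinant_holds`) on fine boxes, see the section docstring.  Why plausibly true: DFI's
error `(N₀N₁)^{3/8}(N₀+N₁)^{11/48}‖a‖‖b‖ x^ε` is `x^{(53/48)(1+θ) − 11σ/48 + ε} < x` for `θ < c(σ)`. Size: XL. -/
theorem stub_pair_balanced : ∀ (f : Fin 2 → ℤ[X]), IsBatemanHornSystem f → (∀ i, (f i).natDegree ≤ 1) →
    ∀ σ : ℝ, 5 / 11 < σ → σ < 1 / 2 →
    ∃ c : ℝ, 0 < c ∧ ∀ θ η : ℝ, 0 < θ → θ ≤ c → 0 < η → η ≤ c →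
      (fun x : ℕ => ∑ n ∈ Finset.Icc 1 x,
        ∑ d ∈ Fintype.piFinset (fun i => (((f i).eval (n : ℤ)).toNat).divisors),
          if (x : ℝ) ^ (1 - η) < ∏ i, (d i : ℝ) ∧ ∏ i, (d i : ℝ) ≤ (x : ℝ) ^ (1 + θ) ∧
              (x : ℝ) ^ σ < ((min (d 0) (d 1) : ℕ) : ℝ) then
            ∏ i, ((ArithmeticFunction.moebius (d i) : ℝ) * Real.log (d i)) else 0)
        =o[atTop] fun x : ℕ => (x : ℝ) :=
  Summit.Parity.BatemanHorn.Theorems.PolyMobiusTail.EtaFreeWindow.stub_pair_balanced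

/-- Pointwise range split of the pair-window summand by the size of `m = min(d₀,d₁)` (`1 ≤ x`):
`[A ∧ B] = [A ∧ B ∧ m ≤ x^{3/10}] + [A ∧ B ∧ x^{3/10} < m ≤ x^{12/25}] + [A ∧ B ∧ x^{12/25} < m]`. -/
theorem pair_summand_split {x : ℕ} (hx : (1 : ℝ) ≤ x) (A B : Prop) [Decidable A] [Decidable B] (m : ℕ)
    (w : ℝ) :
    (if A ∧ B then w else 0) =
      (if A ∧ B ∧ (m : ℝ) ≤ (x : ℝ) ^ (3 / 10 : ℝ) then w else 0) +
      (if A ∧ B ∧ ((x : ℝ) ^ (3 / 10 : ℝ) < m ∧ (m : ℝ) ≤ (x : ℝ) ^ (12 / 25 : ℝ)) then w else 0) +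
      (if A ∧ B ∧ (x : ℝ) ^ (12 / 25 : ℝ) < m then w else 0) := by
  have hmono : (x : ℝ) ^ (3 / 10 : ℝ) ≤ (x : ℝ) ^ (12 / 25 : ℝ) :=
    Real.rpow_le_rpow_of_exponent_le hx (by norm_num)
  by_cases hP : A ∧ B
  · obtain ⟨hA, hB⟩ := hP
    by_cases h1 : (m : ℝ) ≤ (x : ℝ) ^ (3 / 10 : ℝ)
    · have h2 : ¬ ((x : ℝ) ^ (3 / 10 : ℝ) < m ∧ (m : ℝ) ≤ (x : ℝ) ^ (12 / 25 : ℝ)) :=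
        fun h => (not_lt.mpr h1) h.1
      have h3 : ¬ (x : ℝ) ^ (12 / 25 : ℝ) < m := not_lt.mpr (h1.trans hmono)
      rw [if_pos ⟨hA, hB⟩, if_pos ⟨hA, hB, h1⟩, if_neg (fun h => h2 h.2.2), if_neg (fun h => h3 h.2.2)]
      ring
    · push Not at h1
      by_cases h2 : (m : ℝ) ≤ (x : ℝ) ^ (12 / 25 : ℝ)
      · have h3 : ¬ (x : ℝ) ^ (12 / 25 : ℝ) < m := not_lt.mpr h2
        rw [if_pos ⟨hA, hB⟩, if_neg (fun h => (not_le.mpr h1) h.2.2), if_pos ⟨hA, hB, h1, h2⟩,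
          if_neg (fun h => h3 h.2.2)]
        ring
      · push Not at h2
        rw [if_pos ⟨hA, hB⟩, if_neg (fun h => (not_le.mpr h1) h.2.2),
          if_neg (fun h => (not_le.mpr h2) h.2.2.2), if_pos ⟨hA, hB, h2⟩]
        ring
  · rw [if_neg hP, if_neg (fun h => hP ⟨h.1, h.2.1⟩), if_neg (fun h => hP ⟨h.1, h.2.1⟩),
      if_neg (fun h => hP ⟨h.1, h.2.1⟩)]
    ring

/-- **S1b composed (glue, PROVED): the linear PAIR window from the three range stubs.** For a Bateman–Horn
system of two members of degree ≤ 1 some window `(x^{1-η}, x^{1+θ}]` of the Möbius tail is `o(x)`: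
`θ = η = min(c_corner, c_middle, c_balanced, 1/2)` with `σ₁ = 3/10`, `σ₂ = 12/25`. -/
theorem window_linear_pair_of_stubs : ∀ (k : ℕ) (f : Fin k → ℤ[X]), IsBatemanHornSystem f → k = 2 →
    (∀ i, (f i).natDegree ≤ 1) →
    ∃ θ : ℝ, 0 < θ ∧ θ < 1 ∧ ∃ η : ℝ, 0 < η ∧ η < 1 ∧
      (fun x : ℕ => ∑ n ∈ Finset.Icc 1 x,
        ∑ d ∈ Fintype.piFinset (fun i => (((f i).eval (n : ℤ)).toNat).divisors),
          if (x : ℝ) ^ (1 - η) < ∏ i, (d i : ℝ) ∧ ∏ i, (d i : ℝ) ≤ (x : ℝ) ^ (1 + θ) then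
            ∏ i, ((ArithmeticFunction.moebius (d i) : ℝ) * Real.log (d i)) else 0)
        =o[atTop] fun x : ℕ => (x : ℝ) := by
  intro k f hf hk hlin
  subst hk
  obtain ⟨c₁, hc₁, h₁⟩ := stub_pair_corner f hf hlin (3 / 10) (by norm_num) (by norm_num)
  obtain ⟨c₂, hc₂, h₂⟩ :=
    stub_pair_middle f hf hlin (3 / 10) (12 / 25) (by norm_num) (by norm_num) (by norm_num)
  obtain ⟨c₃, hc₃, h₃⟩ := stub_pair_balanced f hf hlin (12 / 25) (by norm_num) (by norm_num)
  set c : ℝ := min (min c₁ c₂) (min c₃ (1 / 2)) with hc_def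
  have hc0 : 0 < c := lt_min (lt_min hc₁ hc₂) (lt_min hc₃ (by norm_num))
  have hcc₁ : c ≤ c₁ := (min_le_left _ _).trans (min_le_left _ _)
  have hcc₂ : c ≤ c₂ := (min_le_left _ _).trans (min_le_right _ _)
  have hcc₃ : c ≤ c₃ := (min_le_right _ _).trans (min_le_left _ _)
  have hc1 : c < 1 := lt_of_le_of_lt ((min_le_right _ _).trans (min_le_right _ _)) (by norm_num)
  refine ⟨c, hc0, hc1, c, hc0, hc1, ?_⟩
  have H := ((h₁ c c hc0 hcc₁ hc0 hcc₁).add (h₂ c c hc0 hcc₂ hc0 hcc₂)).add (h₃ c c hc0 hcc₃ hc0 hcc₃)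
  refine H.congr_left fun x => ?_
  rw [← Finset.sum_add_distrib, ← Finset.sum_add_distrib]
  refine Finset.sum_congr rfl fun n hn => ?_
  rw [← Finset.sum_add_distrib, ← Finset.sum_add_distrib]
  refine Finset.sum_congr rfl fun d _ => ?_
  have hx1 : (1 : ℝ) ≤ (x : ℝ) := by
    have h := Finset.mem_Icc.mp hn
    exact_mod_cast h.1.trans h.2
  exact (pair_summand_split hx1 ((x : ℝ) ^ (1 - c) < ∏ i, (d i : ℝ))
    (∏ i, (d i : ℝ) ≤ (x : ℝ) ^ (1 + c)) (min (d 0) (d 1))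
    (∏ i, ((ArithmeticFunction.moebius (d i) : ℝ) * Real.log (d i)))).symm

/-- **S2 · WINDOW, linear systems with `k ≥ 3` (open, parity-free).** Same window statement for admissible
linear systems `(X + h₁, …, X + h_k)` (more generally all members of degree ≤ 1), `k ≥ 3`. After Poisson on
`D = ∏ dᵢ` the dual phase is `e(−ℓΣhᵢ/D)·∏ᵢ e(ℓhᵢ·d̄ᵢ/(D/dᵢ))` (BarrierNotesIdeator4 B20): a cyclic product
of `k` clean Kloosterman fractions with coefficients `⊗ᵢ μ(dᵢ) log dᵢ`; the corner `min dᵢ ≤ x^{η'}` recurses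
to `k − 1` (BV), a dominant `dᵢ` falls to Cauchy + completion, and the balanced shape `dᵢ ≍ D^{1/k}` needs a
power saving for a genuinely multilinear Kloosterman-fraction sum that is NOT in print (Bettin–Chandee 2018 has
the third variable in the numerator). Why plausibly true: square-root heuristics for each fraction; no parity
obstruction (moduli dense, numerators free). Size: XL / open problem. -/
theorem stub_window_linear_three_le : ∀ (k : ℕ) (f : Fin k → ℤ[X]), IsBatemanHornSystem f → 3 ≤ k →
    (∀ i, (f i).natDegree ≤ 1) →
    ∃ θ : ℝ, 0 < θ ∧ θ < 1 ∧ ∃ η : ℝ, 0 < η ∧ η < 1 ∧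
      (fun x : ℕ => ∑ n ∈ Finset.Icc 1 x,
        ∑ d ∈ Fintype.piFinset (fun i => (((f i).eval (n : ℤ)).toNat).divisors),
          if (x : ℝ) ^ (1 - η) < ∏ i, (d i : ℝ) ∧ ∏ i, (d i : ℝ) ≤ (x : ℝ) ^ (1 + θ) then
            ∏ i, ((ArithmeticFunction.moebius (d i) : ℝ) * Real.log (d i)) else 0)
        =o[atTop] fun x : ℕ => (x : ℝ) := by
  sorry

/-- **S3 · WINDOW, systems with a member of degree ≥ 2 (open, parity-free, graded by degree profile).**
Same window statement when some `fᵢ` has degree ≥ 2: the root numerators of the Kloosterman fractions are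
then entangled with the moduli. `f = (X²+1)`: Grimmelt–Merikoski Type I/II (`grimmeltMerikoski2025_thm14_restr
icted`, `_thm15`) cover everything except the balanced semiprime moduli `d = p·r`, `p ≍ r ≍ x^{(1+θ)/2}`, which
are route GaussianFractions' engine items RootFractionsBound (12214) / RootLevelBeyondHalf (12215); members of
degree ≥ 3: completion barrier B1, generator wall B4, open divisor level B6 — Hooley's `(log D)^{-δ}` only.
This is Sawin–Shusterman's third range ("not yet resolved over ℤ", arXiv:2008.09905 §1.3). Why plausibly
true: Möbius does not correlate with small-root counts of dense moduli; proved verbatim over `𝔽_q[u]`.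
Size: open problem (XL for the quadratic `k = 1` slice modulo 12214). -/
theorem stub_window_nonlinear : ∀ (k : ℕ) (f : Fin k → ℤ[X]), IsBatemanHornSystem f →
    (∃ i, 2 ≤ (f i).natDegree) →
    ∃ θ : ℝ, 0 < θ ∧ θ < 1 ∧ ∃ η : ℝ, 0 < η ∧ η < 1 ∧
      (fun x : ℕ => ∑ n ∈ Finset.Icc 1 x,
        ∑ d ∈ Fintype.piFinset (fun i => (((f i).eval (n : ℤ)).toNat).divisors),
          if (x : ℝ) ^ (1 - η) < ∏ i, (d i : ℝ) ∧ ∏ i, (d i : ℝ) ≤ (x : ℝ) ^ (1 + θ) then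
            ∏ i, ((ArithmeticFunction.moebius (d i) : ℝ) * Real.log (d i)) else 0)
        =o[atTop] fun x : ℕ => (x : ℝ) := by
  sorry

/-- **S4 · LARGE PART in cofactor form — the parity core (open; every system, every `θ ∈ (0,1)`).**
`Σ_{n≤x} Σ_{eᵢ ∣ fᵢ(n), x^{1+θ} < ∏ᵢ fᵢ(n)/eᵢ} ∏ᵢ μ(fᵢ(n)/eᵢ) log(fᵢ(n)/eᵢ) = o(x)`: Möbius of the large
cofactors along the pencils `n ≡ r (mod eᵢ)` with `∏ eᵢ < ∏ fᵢ(n)/x^{1+θ}` (for `k = 1`, `deg f = G`: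
`e < C x^{G−1−θ}`, members `g_{e,r}(j) = f(r+ej)/e` of length `x/e ≥ x^{1+θ−G+1}/C`), with the `(log x)^{-k}`
saving forced by the log weights; its `∏eᵢ = 1` member is `Σ_n ∏ μ(fᵢ(n)) log fᵢ(n)`, i.e. polynomial /
`k`-point Chowla WITH A RATE (items 0871, 9648, 14950 are slices in other currencies). Why plausibly true:
Möbius randomness; true verbatim over `𝔽_q[u]` for separable systems (Sawin–Shusterman Thm 1.3), FALSE there
for inseparable ones (`Literature.Barriers.Parity.FunctionFieldMobiusBias`, no ℤ-counterpart). No tool in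
print over ℤ for any member of degree ≥ 2 or any `k ≥ 2` (Selberg parity; B22 self-duality). Size: summit-hard
on every open slice — the line's avowed residue, ONE stub by design. -/
theorem stub_large : ∀ (k : ℕ) (f : Fin k → ℤ[X]), IsBatemanHornSystem f → ∀ θ : ℝ, 0 < θ → θ < 1 →
    (fun x : ℕ => ∑ n ∈ Finset.Icc 1 x,
      ∑ e ∈ Fintype.piFinset (fun i => (((f i).eval (n : ℤ)).toNat).divisors),
        if (x : ℝ) ^ (1 + θ) < ∏ i, ((((f i).eval (n : ℤ)).toNat / e i : ℕ) : ℝ) then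
          ∏ i, ((ArithmeticFunction.moebius (((f i).eval (n : ℤ)).toNat / e i) : ℝ) *
            Real.log ((((f i).eval (n : ℤ)).toNat / e i : ℕ) : ℝ)) else 0)
      =o[atTop] fun x : ℕ => (x : ℝ) := by
  sorry

/-! ## Glue (all PROVED): the divisor switch and the range split -/

/-- The weight `∏ᵢ μ(dᵢ) log dᵢ` of a divisor tuple. -/
noncomputable def weight {k : ℕ} (d : Fin k → ℕ) : ℝ :=
  ∏ i, ((ArithmeticFunction.moebius (d i) : ℝ) * Real.log (d i))

/-- The crux's tail at cut-off `x^{1-η}` (verbatim the function in `PolyMobiusTail`). -/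
noncomputable def tailSum {k : ℕ} (f : Fin k → ℤ[X]) (η : ℝ) (x : ℕ) : ℝ :=
  ∑ n ∈ Finset.Icc 1 x, ∑ d ∈ Fintype.piFinset (fun i => (((f i).eval (n : ℤ)).toNat).divisors),
    if (x : ℝ) ^ (1 - η) < ∏ i, (d i : ℝ) then weight d else 0

/-- The window `x^{1-η} < ∏ dᵢ ≤ x^{1+θ}` (the function in stubs S1–S3). -/
noncomputable def windowSum {k : ℕ} (f : Fin k → ℤ[X]) (η θ : ℝ) (x : ℕ) : ℝ :=
  ∑ n ∈ Finset.Icc 1 x, ∑ d ∈ Fintype.piFinset (fun i => (((f i).eval (n : ℤ)).toNat).divisors),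
    if (x : ℝ) ^ (1 - η) < ∏ i, (d i : ℝ) ∧ ∏ i, (d i : ℝ) ≤ (x : ℝ) ^ (1 + θ) then weight d else 0

/-- The large part `x^{1+θ} < ∏ dᵢ` in DIVISOR form. -/
noncomputable def largeSumD {k : ℕ} (f : Fin k → ℤ[X]) (θ : ℝ) (x : ℕ) : ℝ :=
  ∑ n ∈ Finset.Icc 1 x, ∑ d ∈ Fintype.piFinset (fun i => (((f i).eval (n : ℤ)).toNat).divisors),
    if (x : ℝ) ^ (1 + θ) < ∏ i, (d i : ℝ) then weight d else 0

/-- The large part in COFACTOR form (the function in stub S4): sum over cofactor tuples `e`, weight and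
size read on `fᵢ(n)/eᵢ`. -/
noncomputable def largeSumE {k : ℕ} (f : Fin k → ℤ[X]) (θ : ℝ) (x : ℕ) : ℝ :=
  ∑ n ∈ Finset.Icc 1 x, ∑ e ∈ Fintype.piFinset (fun i => (((f i).eval (n : ℤ)).toNat).divisors),
    if (x : ℝ) ^ (1 + θ) < ∏ i, ((((f i).eval (n : ℤ)).toNat / e i : ℕ) : ℝ) then
      weight (fun i => ((f i).eval (n : ℤ)).toNat / e i) else 0

/-- **Divisor switch.** For every `x`, the large part in divisor form equals the large part in cofactor
form: coordinatewise `d ↦ fᵢ(n)/dᵢ` is an involution of the divisor tuples of `(f₁(n),…,f_k(n))`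
(`Nat.div_div_self`; tuples exist only when every `fᵢ(n) ≥ 1`). -/
theorem large_divisor_switch {k : ℕ} (f : Fin k → ℤ[X]) (θ : ℝ) (x : ℕ) :
    largeSumD f θ x = largeSumE f θ x := by
  unfold largeSumD largeSumE
  refine Finset.sum_congr rfl fun n _ => ?_
  set m : Fin k → ℕ := fun i => ((f i).eval (n : ℤ)).toNat with hm
  -- membership facts
  have hmem : ∀ d : Fin k → ℕ, d ∈ Fintype.piFinset (fun i => (m i).divisors) →
      ∀ i, d i ∣ m i ∧ m i ≠ 0 := fun d hd i =>
    Nat.mem_divisors.mp ((Fintype.mem_piFinset.mp hd) i)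
  have hmap : ∀ d : Fin k → ℕ, d ∈ Fintype.piFinset (fun i => (m i).divisors) →
      (fun i => m i / d i) ∈ Fintype.piFinset (fun i => (m i).divisors) := by
    intro d hd
    refine Fintype.mem_piFinset.mpr fun i => Nat.mem_divisors.mpr ⟨?_, (hmem d hd i).2⟩
    exact Nat.div_dvd_of_dvd (hmem d hd i).1
  have hinv : ∀ d : Fin k → ℕ, d ∈ Fintype.piFinset (fun i => (m i).divisors) →
      (fun i => m i / (m i / d i)) = d := by
    intro d hd
    funext i
    exact Nat.div_div_self (hmem d hd i).1 (hmem d hd i).2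
  refine Finset.sum_nbij' (fun d i => m i / d i) (fun e i => m i / e i) hmap hmap hinv hinv ?_
  intro d hd
  have key : ∀ i, ((f i).eval (n : ℤ)).toNat / (m i / d i) = d i := fun i =>
    Nat.div_div_self (hmem d hd i).1 (hmem d hd i).2
  simp only [key, weight]

/-- **Range split.** For `0 < η`, `0 ≤ θ` and every `x`:
`Tail_η(x) = Win_{η,θ}(x) + Large_θ(x)` (for `x ≥ 1`, `x^{1-η} ≤ x^{1+θ}` makes the two brackets
complementary inside `x^{1-η} < ∏ dᵢ`; for `x = 0` all three sums are empty). -/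
theorem tail_eq_window_add_large {k : ℕ} (f : Fin k → ℤ[X]) {η θ : ℝ} (hη : 0 < η) (hθ : 0 ≤ θ)
    (x : ℕ) : tailSum f η x = windowSum f η θ x + largeSumD f θ x := by
  unfold tailSum windowSum largeSumD
  rw [← Finset.sum_add_distrib]
  refine Finset.sum_congr rfl fun n hn => ?_
  rw [← Finset.sum_add_distrib]
  refine Finset.sum_congr rfl fun d _ => ?_
  have hx1 : (1 : ℝ) ≤ (x : ℝ) := by
    have h := Finset.mem_Icc.mp hn
    exact_mod_cast h.1.trans h.2
  have hle : (x : ℝ) ^ (1 - η) ≤ (x : ℝ) ^ (1 + θ) :=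
    Real.rpow_le_rpow_of_exponent_le hx1 (by linarith)
  by_cases h1 : ∏ i, (d i : ℝ) ≤ (x : ℝ) ^ (1 + θ)
  · have h2 : ¬ (x : ℝ) ^ (1 + θ) < ∏ i, (d i : ℝ) := not_lt.mpr h1
    by_cases h0 : (x : ℝ) ^ (1 - η) < ∏ i, (d i : ℝ)
    · rw [if_pos h0, if_pos ⟨h0, h1⟩, if_neg h2, add_zero]
    · rw [if_neg h0, if_neg (fun h => h0 h.1), if_neg h2, add_zero]
  · push Not at h1
    have h0 : (x : ℝ) ^ (1 - η) < ∏ i, (d i : ℝ) := lt_of_le_of_lt hle h1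
    rw [if_pos h0, if_neg (fun h => (not_le.mpr h1) h.2), if_pos h1, zero_add]

/-! ## Composition: the five stubs give the crux BY NAME -/

/-- Some window of every system is `o(x)` (case split over the four window stubs). -/
theorem window_of_stubs {k : ℕ} (f : Fin k → ℤ[X]) (hf : IsBatemanHornSystem f) :
    ∃ θ : ℝ, 0 < θ ∧ θ < 1 ∧ ∃ η : ℝ, 0 < η ∧ η < 1 ∧
      (fun x : ℕ => windowSum f η θ x) =o[atTop] fun x : ℕ => (x : ℝ) := by
  by_cases hlin : ∀ i, (f i).natDegree ≤ 1
  · by_cases hk : k ≤ 1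
    · exact window_linear_le_one k f hf hk hlin
    · by_cases hk2 : k = 2
      · exact window_linear_pair_of_stubs k f hf hk2 hlin
      · exact stub_window_linear_three_le k f hf (by omega) hlin
  · push Not at hlin
    obtain ⟨i, hi⟩ := hlin
    exact stub_window_nonlinear k f hf ⟨i, by omega⟩

/-- The large part of every system is `o(x)` at every `θ ∈ (0,1)`, in divisor form (stub S4 + switch). -/
theorem large_of_stub {k : ℕ} (f : Fin k → ℤ[X]) (hf : IsBatemanHornSystem f) {θ : ℝ} (hθ0 : 0 < θ)
    (hθ1 : θ < 1) : (fun x : ℕ => largeSumD f θ x) =o[atTop] fun x : ℕ => (x : ℝ) := by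
  have hE : (fun x : ℕ => largeSumE f θ x) =o[atTop] fun x : ℕ => (x : ℝ) :=
    stub_large k f hf θ hθ0 hθ1
  exact hE.congr_left fun x => (large_divisor_switch f θ x).symm

/-- The tail of every system is `o(x)` at some `η ∈ (0,1)`. -/
theorem tail_of_stubs {k : ℕ} (f : Fin k → ℤ[X]) (hf : IsBatemanHornSystem f) :
    ∃ η : ℝ, 0 < η ∧ η < 1 ∧ (fun x : ℕ => tailSum f η x) =o[atTop] fun x : ℕ => (x : ℝ) := by
  obtain ⟨θ, hθ0, hθ1, η, hη0, hη1, hW⟩ := window_of_stubs f hf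
  have hL := large_of_stub f hf hθ0 hθ1
  refine ⟨η, hη0, hη1, (hW.add hL).congr_left fun x => ?_⟩
  exact (tail_eq_window_add_large f hη0 hθ0.le x).symm

/-- **Composition.** The crux of route IsogenyRedei, BY NAME, from the five stubs. -/
theorem PolyMobiusTail_of : Summit.Parity.BatemanHorn.Theses.IsogenyRedei.PolyMobiusTail := by
  intro k f hf
  exact tail_of_stubs f hf

/-- The identical decl of route PolynomialMobius (and, verbatim, CyclotomicTower / CrossedSalie /
GaussianFractions). -/
theorem PolyMobiusTail_of_polynomialMobius :
    Summit.Parity.BatemanHorn.Theses.PolynomialMobius.PolyMobiusTail :=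
  PolyMobiusTail_of

end Summit.Parity.BatemanHorn.Cruxes.PolyMobiusTail.EtaFreeMultilinearWindow
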